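import Summits.BirchSwinnertonDyer.BirchSwinnertonDyer.Theorems.ByReductionTypeAtTwoTorsionEulerCharTMap
import Summits.BirchSwinnertonDyer.BirchSwinnertonDyer.Theorems.ThetaPartnerAtTwoSignedControlAtTwoH1SigmaKernel
import HarnessLib

set_option linter.dupNamespace false -- `…BirchSwinnertonDyer.BirchSwinnertonDyer…` is the cell's nested layout (D-0017)
set_option autoImplicit false

/-!
# Greenberg LNM 1716 Lemma 4.7 WITH RATIONAL `p`-TORSION, part 8: the INDEX CALCULUS behind the reverse inequality —
# `#ker g₀ = [A′ : U ∩ A′]` (transport `Γ_K = κ⁻¹(p⁰ℤ_p)`) and `[Ã : U] ≤ ∏_{v∈S} #𝒦_{v,0}[p^∞]`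

Cell `bsd-2adic` (run/shared/lean/pub/bsd-2adic/), seat `bsd-2adic-tower-1` GEN 32; `--supports stmt-BirchSwinnertonDyer-19271`
(helper). THEOREMS ONLY (no definition, no named fact, no `sorry`); closes no item; nothing booked; BSD is not proved by any of this.

R. Greenberg, LNM 1716 (1999), §4 Lemma 4.7 (pp. 107–108): in the proof of the «`≤`» half the map `t : 𝒫^Σ(F)/𝒢^Σ(F) →
(Sel_∞)_Γ` (part 7, modulo Lemma 4.6 on `Γ`-invariants) has kernel `(ker r + 𝒢)/𝒢`, of index `[𝒫 : 𝒢]·|ker g|/|ker r|`. In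
the tree's currency (`U` = the receptacle classes of parts 1–5; `Ã` = the classes of `H¹(Γ_K, E[p^∞])` whose restriction to
`K_∞` is Selmer at every place `≠ v₀`; `A′ = Ã ∩ ker loc_{v₀}`) this index calculus is:

* `mem_receptacleClasses_iff` — `u ∈ U ↔ loc_v u = 0` at every finite `v ≠ v₀` and at `∞` (at a good `v ∤ p`, «unramified» =
  «Kummer»: tree `localKerOver_le_unramKer`, `mem_localKerOver_top_of_mem_unramifiedKer`);
* **`natCard_kerG_eq_relIndex`** — `#(A₀/Sel₀) = [A′ : U ∩ A′]` (`W.KerG κ 0` lives at the layer `κ⁻¹(p⁰ℤ_p)`; transport to `Γ_K`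
  along the bijective restriction; `A′ ↦ A₀`, `U ∩ A′ ↦ Sel₀` by Lemma 3.3 at `v₀`, part 7's `eq_zero_of_resOfLe_ker_eq_zero`);
* **`relIndex_le_prod_natCard_localTowerKerPrimary`** — `[Ã : U] ≤ ∏_{v∈S} #𝒦_{v,0}[p^∞]` and `≠ 0`: the evaluation map
  `Ã → ∏_{v∈S} 𝒦_{v,0}[p^∞]` has kernel EXACTLY `U` (off `S ∪ {v₀}` and at `∞` a class dying over `K_∞` is `0` over `K`).

`Ã` enters only through its membership description (as in parts 1–3c). HONEST FRAMING: bookkeeping over tree theorems; no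
Lemma 4.6, no Cassels count is used or proved here; closes no item; the Birch–Swinnerton-Dyer conjecture is NOT proved by this.

References: [GreenbergLNM1716] §3 Lemma 3.3 (pp. 86–87), §4 Lemma 4.7 (pp. 107–108); [GreenbergVatsal2000] §2 pp. 16–17. -/

noncomputable section

open scoped Classical NumberField

open NumberField IsDedekindDomain Field

namespace Summit.BirchSwinnertonDyer.BirchSwinnertonDyer.Theorems.TorsionEulerChar

open Literature.NumberTheory.EllipticCurves Literature.NumberTheory.GaloisRepresentations
  WeierstrassCurve ZpExtension Literature.NumberTheory.EllipticCurves.IwasawaAlgebra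
  Literature.NumberTheory.EllipticCurves.IwasawaDual
  Literature.NumberTheory.EllipticCurves.GreenbergVatsal2000 Literature.NumberTheory.EllipticCurves.GreenbergSelmer
  Literature.NumberTheory.EllipticCurves.Rank1Residual Summit.BirchSwinnertonDyer.Rank1Residual.X2

variable {K : Type} [Field K] [NumberField K] (W : WeierstrassCurve K) [W.IsElliptic] (p : ℕ) [hp : Fact p.Prime]
  (κ : ZpExtension K p)

/-! ## §1 The receptacle's classes `U`: «unramified outside `S ∪ {v₀}`, local class `0` on `S` and at `∞`» ⟺ «local class `0`
at every place `≠ v₀`» -/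

omit hp in
/-- **`u ∈ U ↔ loc_v u = 0` for every finite `v ≠ v₀` and every infinite place**, for `S ⊇ {bad} ∪ {v ∣ p}` and `v₀ ∉ S`: at a
good `v ∤ p` off `S ∪ {v₀}` the unramified condition IS the classical condition at level `Γ_K` (tree: `localKerOver_le_unramKer`,
`SignedEC.H1SigmaCorank.mem_localKerOver_top_of_mem_unramifiedKer`); conjugation acts trivially on `H¹(Γ_K, ·)`.
[cite: GreenbergVatsal2000, §2 p. 17] [cite: GreenbergLNM1716, §3 Lemma 3.3 (pp. 86–87)] -/
theorem mem_receptacleClasses_iff (S : Finset (HeightOneSpectrum (𝓞 K)))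
    (hS : ∀ v ∉ S, ((p : ℕ) : 𝓞 K) ∉ v.asIdeal ∧ W.HasGoodReductionAt v)
    (v₀ : HeightOneSpectrum (𝓞 K)) (hv₀ : v₀ ∉ S) (u : W.subgroupH1 p (⊤ : Subgroup (absoluteGaloisGroup K))) :
    u ∈ unramifiedOutside (⊤ : Subgroup (absoluteGaloisGroup K)) (W.geomPrimaryTorsion p) p
          ((↑S : Set (HeightOneSpectrum (𝓞 K))) ∪ {v₀}) ⊓
        (⨅ v ∈ S, W.localKerOver p ⊤ (v.adicCompletion K)) ⊓
        (⨅ w : InfinitePlace K, W.localKerOver p ⊤ w.Completion) ↔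
      (∀ v : HeightOneSpectrum (𝓞 K), v ≠ v₀ → W.localResOver p ⊤ (v.adicCompletion K) u = 0) ∧
        ∀ w : InfinitePlace K, W.localResOver p ⊤ w.Completion u = 0 := by
  have hconj : ∀ σ : absoluteGaloisGroup K,
      Literature.NumberTheory.EllipticCurves.conjH1 ⊤ (W.geomPrimaryTorsion p) σ = AddMonoidHom.id _ :=
    fun σ ↦ W.conjH1_of_mem_holds p ⊤ (Subgroup.mem_top σ)
  simp only [AddSubgroup.mem_inf, AddSubgroup.mem_iInf]
  constructor
  · rintro ⟨⟨hunr, hS0⟩, hinf⟩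
    refine ⟨fun v hv ↦ ?_, fun w ↦ (W.mem_localKerOver_iff p ⊤ _ u).mp (hinf w)⟩
    by_cases hvS : v ∈ S
    · exact (W.mem_localKerOver_iff p ⊤ _ u).mp (hS0 v hvS)
    · have hmem : v ∉ ((↑S : Set (HeightOneSpectrum (𝓞 K))) ∪ {v₀}) := fun h ↦ by
        rcases h with h | h
        · exact hvS (Finset.mem_coe.mp h)
        · exact hv (Set.mem_singleton_iff.mp h)
      have hu := (mem_unramifiedOutside_iff u).mp hunr v hmem (hS v hvS).1 1
      rw [hconj 1, AddMonoidHom.id_apply] at hu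
      exact (W.mem_localKerOver_iff p ⊤ _ u).mp
        (SignedEC.H1SigmaCorank.mem_localKerOver_top_of_mem_unramifiedKer W p (hS v hvS).2 u hu)
  · rintro ⟨hfin, hinf⟩
    refine ⟨⟨?_, fun v hv ↦ (W.mem_localKerOver_iff p ⊤ _ u).mpr (hfin v fun h ↦ hv₀ (h ▸ hv))⟩,
      fun w ↦ (W.mem_localKerOver_iff p ⊤ _ u).mpr (hinf w)⟩
    rw [mem_unramifiedOutside_iff]
    intro v hv hpv σ
    rw [hconj σ, AddMonoidHom.id_apply]
    have hvS : v ∉ S := fun h ↦ hv (Set.mem_union_left _ (Finset.mem_coe.mpr h))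
    have hvne : v ≠ v₀ := fun h ↦ hv (Set.mem_union_right _ (Set.mem_singleton_iff.mpr h))
    exact GreenbergVatsalSelmerLink.localKerOver_le_unramKer (W := W) (p := p) (H := ⊤) (hS v hvS).2 hpv
      ((W.mem_localKerOver_iff p ⊤ _ u).mpr (hfin v hvne))

/-! ## §2 Transport `Γ_K = κ⁻¹(p⁰ℤ_p)`: `#(A₀/Sel₀) = [A′ : U ∩ A′]` -/

section Transport

variable {γ : absoluteGaloisGroup K}

omit [NumberField K] [W.IsElliptic] in
/-- The restriction `ρ : H¹(Γ_K, E[p^∞]) → H¹(κ⁻¹(p⁰ℤ_p), E[p^∞])` along `κ⁻¹(p⁰ℤ_p) ≤ ⊤` has the two-sided inverse `res`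
along `⊤ ≤ κ⁻¹(p⁰ℤ_p)` (`ZpExtension.layerSubgroup_zero`). [folklore] -/
theorem resOfLe_layerZero_round (y : W.subgroupH1 p (⊤ : Subgroup (absoluteGaloisGroup K)))
    (htop : (⊤ : Subgroup (absoluteGaloisGroup K)) ≤ κ.layerSubgroup 0) :
    W.resOfLe p htop (W.resOfLe p (le_top : κ.layerSubgroup 0 ≤ ⊤) y) = y :=
  (DFunLike.congr_fun (W.resOfLe_comp_holds p htop (le_top : κ.layerSubgroup 0 ≤ ⊤)) y).trans
    (DFunLike.congr_fun (resOfLe_refl_holds (M := W.geomPrimaryTorsion p) _) y)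

omit [NumberField K] [W.IsElliptic] in
/-- The other round trip. [folklore] -/
theorem resOfLe_layerZero_round' (y₀ : W.subgroupH1 p (κ.layerSubgroup 0))
    (htop : (⊤ : Subgroup (absoluteGaloisGroup K)) ≤ κ.layerSubgroup 0) :
    W.resOfLe p (le_top : κ.layerSubgroup 0 ≤ ⊤) (W.resOfLe p htop y₀) = y₀ :=
  (DFunLike.congr_fun (W.resOfLe_comp_holds p (le_top : κ.layerSubgroup 0 ≤ ⊤) htop) y₀).trans
    (DFunLike.congr_fun (resOfLe_refl_holds (M := W.geomPrimaryTorsion p) _) y₀)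

omit [NumberField K] [W.IsElliptic] in
/-- `h₀ ∘ ρ = res : H¹(Γ_K, E[p^∞]) → H¹(K_∞, E[p^∞])` (transitivity of restriction). [folklore] -/
theorem layerToInfty_resOfLe_layerZero (y : W.subgroupH1 p (⊤ : Subgroup (absoluteGaloisGroup K))) :
    W.layerToInfty κ 0 (W.resOfLe p (le_top : κ.layerSubgroup 0 ≤ ⊤) y) = W.resOfLe p (le_top : κ.kerSubgroup ≤ ⊤) y :=
  DFunLike.congr_fun (W.resOfLe_comp_holds p (κ.kerSubgroup_le_layerSubgroup 0) (le_top : κ.layerSubgroup 0 ≤ ⊤)) y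

omit [NumberField K] [W.IsElliptic] in
/-- `loc⁰_E ∘ ρ = res ∘ loc^⊤_E` at every completion `E` (localisation commutes with restriction). [folklore] -/
theorem localResOver_layerZero_resOfLe {E : Type} [Field E] [Algebra K E]
    (y : W.subgroupH1 p (⊤ : Subgroup (absoluteGaloisGroup K))) :
    W.localResOver p (κ.layerSubgroup 0) E (W.resOfLe p (le_top : κ.layerSubgroup 0 ≤ ⊤) y) =
      Literature.NumberTheory.EllipticCurves.resOfLe (localPoints W E)
        (Subgroup.comap_mono le_top : localSubgroup (κ.layerSubgroup 0) E ≤ localSubgroup (⊤ : Subgroup (absoluteGaloisGroup K)) E)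
        (W.localResOver p ⊤ E y) :=
  W.localResOverOfEmb_resOfLe p (closureEmb (K := K) E) (le_top : κ.layerSubgroup 0 ≤ ⊤) y

omit [NumberField K] [W.IsElliptic] in
/-- `res_{∞/0} ∘ res_{0/⊤} = res_{∞/⊤}` on local classes (transitivity of restriction, stated for rewriting). [folklore] -/
theorem resOfLe_ker_resOfLe_layerZero {E : Type} [Field E] [Algebra K E]
    (x : discreteH1 (localSubgroup (⊤ : Subgroup (absoluteGaloisGroup K)) E) (localPoints W E)) :
    Literature.NumberTheory.EllipticCurves.resOfLe (localPoints W E) (localSubgroup_ker_le_layer κ E 0)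
        (Literature.NumberTheory.EllipticCurves.resOfLe (localPoints W E)
          (Subgroup.comap_mono le_top :
            localSubgroup (κ.layerSubgroup 0) E ≤ localSubgroup (⊤ : Subgroup (absoluteGaloisGroup K)) E) x) =
      Literature.NumberTheory.EllipticCurves.resOfLe (localPoints W E)
        (Subgroup.comap_mono le_top : localSubgroup κ.kerSubgroup E ≤ localSubgroup (⊤ : Subgroup (absoluteGaloisGroup K)) E)
        x :=
  DFunLike.congr_fun (resOfLe_comp_holds (M := localPoints W E) (localSubgroup_ker_le_layer κ E 0)
    (Subgroup.comap_mono le_top :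
      localSubgroup (κ.layerSubgroup 0) E ≤ localSubgroup (⊤ : Subgroup (absoluteGaloisGroup K)) E)) x

/-- **`#(A₀/Sel₀) = [A′ : U ∩ A′]`.** For `W/K` elliptic, the `ℤ_p`-extension `κ`, `S ⊇ {bad} ∪ {v ∣ p}`, `v₀ ∉ S`, and the
subgroup `Ã ≤ H¹(Γ_K, E[p^∞])` of classes whose restriction to `K_∞` is Selmer at every place `≠ v₀` (given by its membership
description `hA`): Greenberg's `ker g₀ = A₀/Sel₀` (`W.KerG κ 0`, at the layer `κ⁻¹(p⁰ℤ_p)`) has the cardinality of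
`A′/(U ∩ A′)`, `A′ = Ã ∩ ker loc_{v₀}`, i.e. `Nat.card (W.KerG κ 0) = U.relIndex A′` — transport along the bijective restriction
`H¹(Γ_K, ·) → H¹(κ⁻¹(p⁰ℤ_p), ·)`: `A′ ↦ A₀` (at `v₀` a Selmer class over `K_∞` has local class `0`, and a class of `Γ_K` dying
over `K_∞` at the GOOD place `v₀ ∤ p` is `0` by Lemma 3.3) and `U ∩ A′ ↦ Sel₀`.
[cite: GreenbergLNM1716, §3 p. 90 (ker g_n) and Lemma 3.3 (pp. 86–87), §4 Lemma 4.7 (p. 108)] -/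
theorem natCard_kerG_eq_relIndex (S : Finset (HeightOneSpectrum (𝓞 K)))
    (hS : ∀ v ∉ S, ((p : ℕ) : 𝓞 K) ∉ v.asIdeal ∧ W.HasGoodReductionAt v)
    (v₀ : HeightOneSpectrum (𝓞 K)) (hv₀ : v₀ ∉ S)
    (A : AddSubgroup (W.subgroupH1 p (⊤ : Subgroup (absoluteGaloisGroup K))))
    (hA : ∀ y : W.subgroupH1 p (⊤ : Subgroup (absoluteGaloisGroup K)), y ∈ A ↔
      (∀ v : HeightOneSpectrum (𝓞 K), v ≠ v₀ → ∀ σ : absoluteGaloisGroup K,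
        W.conjH1 p κ.kerSubgroup σ (W.resOfLe p (le_top : κ.kerSubgroup ≤ ⊤) y) ∈
          W.localKerOver p κ.kerSubgroup (v.adicCompletion K)) ∧
      ∀ (w : InfinitePlace K) (σ : absoluteGaloisGroup K),
        W.conjH1 p κ.kerSubgroup σ (W.resOfLe p (le_top : κ.kerSubgroup ≤ ⊤) y) ∈
          W.localKerOver p κ.kerSubgroup w.Completion) :
    Nat.card (W.KerG κ 0) =
      (unramifiedOutside (⊤ : Subgroup (absoluteGaloisGroup K)) (W.geomPrimaryTorsion p) p
            ((↑S : Set (HeightOneSpectrum (𝓞 K))) ∪ {v₀}) ⊓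
          (⨅ v ∈ S, W.localKerOver p ⊤ (v.adicCompletion K)) ⊓
          (⨅ w : InfinitePlace K, W.localKerOver p ⊤ w.Completion)).relIndex
        (A ⊓ (W.localResOver p ⊤ (v₀.adicCompletion K)).ker) := by
  have hpv₀ : ((p : ℕ) : 𝓞 K) ∉ v₀.asIdeal := (hS v₀ hv₀).1
  have hgood₀ : W.HasGoodReductionAt v₀ := (hS v₀ hv₀).2
  -- notation
  set U : AddSubgroup (W.subgroupH1 p (⊤ : Subgroup (absoluteGaloisGroup K))) :=
    unramifiedOutside (⊤ : Subgroup (absoluteGaloisGroup K)) (W.geomPrimaryTorsion p) p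
        ((↑S : Set (HeightOneSpectrum (𝓞 K))) ∪ {v₀}) ⊓
      (⨅ v ∈ S, W.localKerOver p ⊤ (v.adicCompletion K)) ⊓
      (⨅ w : InfinitePlace K, W.localKerOver p ⊤ w.Completion) with hUdef
  have hU : ∀ u, u ∈ U ↔ (∀ v : HeightOneSpectrum (𝓞 K), v ≠ v₀ → W.localResOver p ⊤ (v.adicCompletion K) u = 0) ∧
      ∀ w : InfinitePlace K, W.localResOver p ⊤ w.Completion u = 0 :=
    fun u ↦ mem_receptacleClasses_iff W p S hS v₀ hv₀ u
  set A' : AddSubgroup (W.subgroupH1 p (⊤ : Subgroup (absoluteGaloisGroup K))) :=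
    A ⊓ (W.localResOver p ⊤ (v₀.adicCompletion K)).ker with hA'def
  have hA' : ∀ y, y ∈ A' ↔ y ∈ A ∧ W.localResOver p ⊤ (v₀.adicCompletion K) y = 0 := fun y ↦ by
    rw [hA'def, AddSubgroup.mem_inf, AddMonoidHom.mem_ker]
  let A₀ : AddSubgroup (W.subgroupH1 p (κ.layerSubgroup 0)) := W.selmerInftyPreimage κ 0
  let Sel₀ : AddSubgroup (W.subgroupH1 p (κ.layerSubgroup 0)) := W.selmerLayer κ 0
  have htop : (⊤ : Subgroup (absoluteGaloisGroup K)) ≤ κ.layerSubgroup 0 :=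
    fun g _ ↦ by rw [ZpExtension.layerSubgroup_zero]; trivial
  let ρ : W.subgroupH1 p (⊤ : Subgroup (absoluteGaloisGroup K)) →+ W.subgroupH1 p (κ.layerSubgroup 0) :=
    W.resOfLe p (le_top : κ.layerSubgroup 0 ≤ ⊤)
  have hρinj : Function.Injective ρ := fun y y' h ↦ by
    rw [← resOfLe_layerZero_round W p κ y htop, ← resOfLe_layerZero_round W p κ y' htop]
    exact congrArg _ h
  have hconj0 : ∀ σ : absoluteGaloisGroup K, W.conjH1 p (κ.layerSubgroup 0) σ = AddMonoidHom.id _ := fun σ ↦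
    W.conjH1_of_mem_holds p (κ.layerSubgroup 0) (by rw [ZpExtension.layerSubgroup_zero]; trivial)
  have hone : W.conjH1 p κ.kerSubgroup 1 = AddMonoidHom.id _ := W.conjH1_one_holds p κ.kerSubgroup
  have hlocInf : ∀ (E : Type) [Field E] [Algebra K E] (y : W.subgroupH1 p (⊤ : Subgroup (absoluteGaloisGroup K))),
      W.resOfLe p (le_top : κ.kerSubgroup ≤ ⊤) y ∈ W.localKerOver p κ.kerSubgroup E ↔
        Literature.NumberTheory.EllipticCurves.resOfLe (localPoints W E)
          (Subgroup.comap_mono le_top : localSubgroup κ.kerSubgroup E ≤ localSubgroup (⊤ : Subgroup (absoluteGaloisGroup K)) E)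
          (W.localResOver p ⊤ E y) = 0 := by
    intro E _ _ y
    rw [W.mem_localKerOver_iff]
    exact ⟨fun h ↦ (localResOver_resOfLe_top W p κ y).symm.trans h, fun h ↦ (localResOver_resOfLe_top W p κ y).trans h⟩
  -- (T1) `ρ(A′) = A₀`
  have hT1 : A'.map ρ = A₀ := by
    ext y₀
    constructor
    · rintro ⟨y, hy, rfl⟩
      obtain ⟨hyA, hy0⟩ := (hA' y).mp hy
      obtain ⟨hyv, hyw⟩ := (hA y).mp hyA
      change W.layerToInfty κ 0 (ρ y) ∈ W.selmerInfty κ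
      rw [layerToInfty_resOfLe_layerZero W p κ y]
      refine (W.mem_selmerGroupOver_iff p κ.kerSubgroup _).mpr ⟨fun v σ ↦ ?_, fun w σ ↦ hyw w σ⟩
      by_cases hv : v = v₀
      · subst hv
        rw [SSFlatEC.conjH1_resOfLe_top W κ σ y, hlocInf _ y, hy0]
        exact map_zero _
      · exact hyv v hv σ
    · intro hy₀
      refine ⟨W.resOfLe p htop y₀, ?_, resOfLe_layerZero_round' W p κ y₀ htop⟩
      have hres : W.resOfLe p (le_top : κ.kerSubgroup ≤ ⊤) (W.resOfLe p htop y₀) = W.layerToInfty κ 0 y₀ := by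
        rw [← layerToInfty_resOfLe_layerZero W p κ, resOfLe_layerZero_round' W p κ y₀ htop]
      have hsel := (W.mem_selmerGroupOver_iff p κ.kerSubgroup _).mp ((W.mem_selmerInftyPreimage_iff κ 0 y₀).mp hy₀)
      refine (hA' _).mpr ⟨(hA _).mpr ⟨fun v _ σ ↦ ?_, fun w σ ↦ ?_⟩, ?_⟩
      · rw [hres]; exact hsel.1 v σ
      · rw [hres]; exact hsel.2 w σ
      · -- at `v₀`: the Selmer class `h₀ y₀` has local class `0` over `K_∞`; Lemma 3.3 descends it to `Γ_K`
        have h1 : W.resOfLe p (le_top : κ.kerSubgroup ≤ ⊤) (W.resOfLe p htop y₀) ∈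
            W.localKerOver p κ.kerSubgroup (v₀.adicCompletion K) := by
          rw [hres]
          have h := hsel.1 v₀ 1
          rwa [hone, AddMonoidHom.id_apply] at h
        exact eq_zero_of_resOfLe_ker_eq_zero W p κ hpv₀ hgood₀ _
          (SignedEC.H1SigmaCorank.exists_pow_smul_eq_zero_subgroupH1_top W p _ |>.imp fun k hk ↦ by
            rw [← map_nsmul, hk, map_zero])
          ((hlocInf _ _).mp h1)
  -- (T2) `ρ(U) ∩ A₀ = Sel₀ ∩ A₀`
  have hT2 : U.map ρ ⊓ A₀ = Sel₀ ⊓ A₀ := by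
    ext y₀
    simp only [AddSubgroup.mem_inf]
    constructor
    · rintro ⟨⟨u, hu, rfl⟩, hu₀⟩
      refine ⟨?_, hu₀⟩
      obtain ⟨hufin, huinf⟩ := (hU u).mp hu
      -- at `v₀`: `h₀(ρ u) = res u ∈ Sel_∞`, so the local class of `u` dies over `K_∞`, hence is `0` (Lemma 3.3)
      have hsel := (W.mem_selmerGroupOver_iff p κ.kerSubgroup _).mp ((W.mem_selmerInftyPreimage_iff κ 0 _).mp hu₀)
      have hu0 : W.localResOver p ⊤ (v₀.adicCompletion K) u = 0 := by
        have h := hsel.1 v₀ 1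
        rw [hone, AddMonoidHom.id_apply, layerToInfty_resOfLe_layerZero W p κ u, hlocInf _ u] at h
        exact eq_zero_of_resOfLe_ker_eq_zero W p κ hpv₀ hgood₀ _
          (SignedEC.H1SigmaCorank.exists_pow_smul_eq_zero_subgroupH1_top W p _ |>.imp fun k hk ↦ by
            rw [← map_nsmul, hk, map_zero]) h
      have hall : ∀ v : HeightOneSpectrum (𝓞 K), W.localResOver p ⊤ (v.adicCompletion K) u = 0 := fun v ↦ by
        by_cases hv : v = v₀
        · subst hv; exact hu0
        · exact hufin v hv
      refine (W.mem_selmerGroupOver_iff p (κ.layerSubgroup 0) _).mpr ⟨fun v σ ↦ ?_, fun w σ ↦ ?_⟩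
      · rw [hconj0 σ, AddMonoidHom.id_apply, W.mem_localKerOver_iff, localResOver_layerZero_resOfLe W p κ u, hall v]
        exact map_zero _
      · rw [hconj0 σ, AddMonoidHom.id_apply, W.mem_localKerOver_iff, localResOver_layerZero_resOfLe W p κ u, huinf w]
        exact map_zero _
    · rintro ⟨hy₀, hu₀⟩
      refine ⟨⟨W.resOfLe p htop y₀, ?_, resOfLe_layerZero_round' W p κ y₀ htop⟩, hu₀⟩
      have hsel0 := (W.mem_selmerGroupOver_iff p (κ.layerSubgroup 0) _).mp hy₀
      have hy₀' : W.resOfLe p (le_top : κ.layerSubgroup 0 ≤ ⊤) (W.resOfLe p htop y₀) = y₀ :=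
        resOfLe_layerZero_round' W p κ y₀ htop
      refine (hU _).mpr ⟨fun v _ ↦ ?_, fun w ↦ ?_⟩
      · have h := hsel0.1 v 1
        rw [W.conjH1_one_holds p (κ.layerSubgroup 0), AddMonoidHom.id_apply, W.mem_localKerOver_iff, ← hy₀',
          localResOver_layerZero_resOfLe W p κ] at h
        exact eq_zero_of_resOfLe_layer_zero_eq_zero W p κ _ h
      · have h := hsel0.2 w 1
        rw [W.conjH1_one_holds p (κ.layerSubgroup 0), AddMonoidHom.id_apply, W.mem_localKerOver_iff, ← hy₀',
          localResOver_layerZero_resOfLe W p κ] at h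
        exact eq_zero_of_resOfLe_layer_zero_eq_zero W p κ _ h
  calc Nat.card (W.KerG κ 0) = (Sel₀.addSubgroupOf A₀).index := (AddSubgroup.index_eq_card _).symm
    _ = Sel₀.relIndex A₀ := rfl
    _ = (Sel₀ ⊓ A₀).relIndex A₀ := (AddSubgroup.inf_relIndex_right Sel₀ A₀).symm
    _ = (U.map ρ ⊓ A₀).relIndex A₀ := by rw [hT2]
    _ = (U.map ρ).relIndex A₀ := AddSubgroup.inf_relIndex_right _ _
    _ = (U.map ρ).relIndex (A'.map ρ) := by rw [hT1]
    _ = U.relIndex A' := AddSubgroup.relIndex_map_map_of_injective U A' hρinj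

end Transport
/-! ## §3 `[Ã : U] ≤ ∏_{v∈S} #𝒦_{v,0}[p^∞]` -/

/-- **`[Ã : U] ≤ ∏_{v∈S} #𝒦_{v,0}[p^∞]`, and `[Ã : U] ≠ 0`.** For `W/K` elliptic, the `ℤ_p`-extension `κ`, `S ⊇ {bad} ∪ {v ∣ p}`
with `𝒦_{v,0}[p^∞]` finite on `S`, `v₀ ∉ S`, and `Ã` the classes of `H¹(Γ_K, E[p^∞])` whose restriction to `K_∞` is Selmer at
every place `≠ v₀`: `y ↦ (loc_v y)_{v ∈ S}` maps `Ã` into `∏_{v∈S} 𝒦_{v,0}[p^∞]` with kernel EXACTLY `U` (a class of `Ã`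
vanishing on `S` vanishes at every `v ≠ v₀`: off `S` by Lemma 3.3, at `∞` because the local groups of `K` and `K_∞` coincide).
[cite: GreenbergLNM1716, §3 Lemma 3.3 (pp. 86–87), §4 Lemma 4.4 (p. 104) and Lemma 4.7 (p. 108)] -/
theorem relIndex_le_prod_natCard_localTowerKerPrimary (S : Finset (HeightOneSpectrum (𝓞 K)))
    (hS : ∀ v ∉ S, ((p : ℕ) : 𝓞 K) ∉ v.asIdeal ∧ W.HasGoodReductionAt v)
    (v₀ : HeightOneSpectrum (𝓞 K)) (hv₀ : v₀ ∉ S)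
    (hT : ∀ v ∈ S, Finite (W.localTowerKerPrimary κ (v.adicCompletion K) 0))
    (A : AddSubgroup (W.subgroupH1 p (⊤ : Subgroup (absoluteGaloisGroup K))))
    (hA : ∀ y : W.subgroupH1 p (⊤ : Subgroup (absoluteGaloisGroup K)), y ∈ A ↔
      (∀ v : HeightOneSpectrum (𝓞 K), v ≠ v₀ → ∀ σ : absoluteGaloisGroup K,
        W.conjH1 p κ.kerSubgroup σ (W.resOfLe p (le_top : κ.kerSubgroup ≤ ⊤) y) ∈
          W.localKerOver p κ.kerSubgroup (v.adicCompletion K)) ∧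
      ∀ (w : InfinitePlace K) (σ : absoluteGaloisGroup K),
        W.conjH1 p κ.kerSubgroup σ (W.resOfLe p (le_top : κ.kerSubgroup ≤ ⊤) y) ∈
          W.localKerOver p κ.kerSubgroup w.Completion) :
    (unramifiedOutside (⊤ : Subgroup (absoluteGaloisGroup K)) (W.geomPrimaryTorsion p) p
            ((↑S : Set (HeightOneSpectrum (𝓞 K))) ∪ {v₀}) ⊓
          (⨅ v ∈ S, W.localKerOver p ⊤ (v.adicCompletion K)) ⊓
          (⨅ w : InfinitePlace K, W.localKerOver p ⊤ w.Completion)).relIndex A ≤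
        ∏ v ∈ S, Nat.card (W.localTowerKerPrimary κ (v.adicCompletion K) 0) ∧
      (unramifiedOutside (⊤ : Subgroup (absoluteGaloisGroup K)) (W.geomPrimaryTorsion p) p
            ((↑S : Set (HeightOneSpectrum (𝓞 K))) ∪ {v₀}) ⊓
          (⨅ v ∈ S, W.localKerOver p ⊤ (v.adicCompletion K)) ⊓
          (⨅ w : InfinitePlace K, W.localKerOver p ⊤ w.Completion)).relIndex A ≠ 0 := by
  set U : AddSubgroup (W.subgroupH1 p (⊤ : Subgroup (absoluteGaloisGroup K))) :=
    unramifiedOutside (⊤ : Subgroup (absoluteGaloisGroup K)) (W.geomPrimaryTorsion p) p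
        ((↑S : Set (HeightOneSpectrum (𝓞 K))) ∪ {v₀}) ⊓
      (⨅ v ∈ S, W.localKerOver p ⊤ (v.adicCompletion K)) ⊓
      (⨅ w : InfinitePlace K, W.localKerOver p ⊤ w.Completion) with hUdef
  have hU : ∀ u, u ∈ U ↔ (∀ v : HeightOneSpectrum (𝓞 K), v ≠ v₀ → W.localResOver p ⊤ (v.adicCompletion K) u = 0) ∧
      ∀ w : InfinitePlace K, W.localResOver p ⊤ w.Completion u = 0 :=
    fun u ↦ mem_receptacleClasses_iff W p S hS v₀ hv₀ u
  have hone : W.conjH1 p κ.kerSubgroup 1 = AddMonoidHom.id _ := W.conjH1_one_holds p κ.kerSubgroup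
  -- the local classes of `y ∈ Ã` at `v ∈ S`, read at the layer `0`, lie in `𝒦_{v,0}[p^∞]`
  let T : HeightOneSpectrum (𝓞 K) → Type := fun v ↦ W.localTowerKerPrimary κ (v.adicCompletion K) 0
  let ev : ∀ v : HeightOneSpectrum (𝓞 K), W.subgroupH1 p (⊤ : Subgroup (absoluteGaloisGroup K)) →+
      discreteH1 (localSubgroup (κ.layerSubgroup 0) (v.adicCompletion K)) (localPoints W (v.adicCompletion K)) := fun v ↦
    (Literature.NumberTheory.EllipticCurves.resOfLe (localPoints W (v.adicCompletion K))
      (Subgroup.comap_mono le_top :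
        localSubgroup (κ.layerSubgroup 0) (v.adicCompletion K) ≤
          localSubgroup (⊤ : Subgroup (absoluteGaloisGroup K)) (v.adicCompletion K))).comp
      (W.localResOver p ⊤ (v.adicCompletion K))
  have hev : ∀ v y, ev v y = Literature.NumberTheory.EllipticCurves.resOfLe (localPoints W (v.adicCompletion K))
      (Subgroup.comap_mono le_top :
        localSubgroup (κ.layerSubgroup 0) (v.adicCompletion K) ≤
          localSubgroup (⊤ : Subgroup (absoluteGaloisGroup K)) (v.adicCompletion K))
      (W.localResOver p ⊤ (v.adicCompletion K) y) := fun _ _ ↦ rfl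
  have hmemT : ∀ y : A, ∀ v : S, ev v.1 y ∈ W.localTowerKerPrimary κ (v.1.adicCompletion K) 0 := by
    intro y v
    obtain ⟨hyv, -⟩ := (hA y).mp y.2
    have hvne : (v : HeightOneSpectrum (𝓞 K)) ≠ v₀ := fun h ↦ hv₀ (h ▸ v.2)
    refine (W.mem_localTowerKerPrimary_iff κ _ 0 _).mpr ⟨?_, ?_⟩
    · have h := hyv v.1 hvne 1
      rw [hone, AddMonoidHom.id_apply, W.mem_localKerOver_iff] at h
      rw [W.mem_localTowerKer_iff κ, hev]
      exact (resOfLe_ker_resOfLe_layerZero W p κ _).trans ((localResOver_resOfLe_top W p κ _).symm.trans h)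
    · obtain ⟨k, hk⟩ := SignedEC.H1SigmaCorank.exists_pow_smul_eq_zero_subgroupH1_top W p (y : W.subgroupH1 p ⊤)
      exact ⟨k, by rw [← map_nsmul, hk, map_zero]⟩
  let Φ : A →+ (∀ v : S, T v.1) :=
    { toFun := fun y v ↦ ⟨ev v.1 y, hmemT y v⟩
      map_zero' := funext fun v ↦ Subtype.ext (by simp)
      map_add' := fun y y' ↦ funext fun v ↦ Subtype.ext (by simp) }
  have hΦ : ∀ (y : A) (v : S), ((Φ y v : T v.1) : _) = ev v.1 y := fun _ _ ↦ rfl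
  -- `ker Φ = U ∩ Ã`
  have hker : Φ.ker = U.addSubgroupOf A := by
    ext y
    rw [AddMonoidHom.mem_ker, AddSubgroup.mem_addSubgroupOf, hU]
    obtain ⟨hyv, hyw⟩ := (hA y).mp y.2
    constructor
    · intro h0
      have hS0 : ∀ v ∈ S, W.localResOver p ⊤ (v.adicCompletion K) y = 0 := fun v hv ↦ by
        have h := congrArg (fun f ↦ ((f ⟨v, hv⟩ : T v) : discreteH1 (localSubgroup (κ.layerSubgroup 0) (v.adicCompletion K))
          (localPoints W (v.adicCompletion K)))) h0
        simp only [hΦ, Pi.zero_apply, ZeroMemClass.coe_zero] at h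
        exact eq_zero_of_resOfLe_layer_zero_eq_zero W p κ _ h
      refine ⟨fun v hv ↦ ?_, fun w ↦ ?_⟩
      · by_cases hvS : v ∈ S
        · exact hS0 v hvS
        · -- off `S`: the class dies over `K_∞` (Selmer there), hence is `0` at the good place `v ∤ p`
          have h := hyv v hv 1
          rw [hone, AddMonoidHom.id_apply, W.mem_localKerOver_iff] at h
          exact eq_zero_of_resOfLe_ker_eq_zero W p κ (hS v hvS).1 (hS v hvS).2 _
            (SignedEC.H1SigmaCorank.exists_pow_smul_eq_zero_subgroupH1_top W p _ |>.imp fun k hk ↦ by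
              rw [← map_nsmul, hk, map_zero]) ((localResOver_resOfLe_top W p κ _).symm.trans h)
      · have h := hyw w 1
        rw [hone, AddMonoidHom.id_apply, W.mem_localKerOver_iff] at h
        exact eq_zero_of_resOfLe_ker_eq_zero_infinitePlace W p κ w _ ((localResOver_resOfLe_top W p κ _).symm.trans h)
    · rintro ⟨hfin, -⟩
      funext v
      apply Subtype.ext
      rw [hΦ, Pi.zero_apply, ZeroMemClass.coe_zero, hev, hfin v.1 (fun h ↦ hv₀ (h ▸ v.2))]
      exact map_zero _
  haveI : ∀ v : S, Finite (T v.1) := fun v ↦ hT v.1 v.2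
  haveI : Finite (∀ v : S, T v.1) := Pi.finite
  have hidx : U.relIndex A = Nat.card Φ.range := by
    rw [AddSubgroup.relIndex, ← hker]
    exact AddSubgroup.index_ker Φ
  have hprod : Nat.card (∀ v : S, T v.1) = ∏ v ∈ S, Nat.card (T v) := by
    rw [Nat.card_pi, Finset.prod_coe_sort S (fun v ↦ Nat.card (T v))]
  refine ⟨?_, ?_⟩
  · rw [hidx, ← hprod]
    exact Nat.card_le_card_of_injective _ Φ.range.subtype_injective
  · rw [hidx]
    exact (Nat.card_pos (α := Φ.range)).ne'

end Summit.BirchSwinnertonDyer.BirchSwinnertonDyer.Theorems.TorsionEulerChar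

end
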